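import Summits.MatrixMultiplication.OmegaCensus.SmallFormats.MatMul22nRankGF5XCapCosetDataK
import Summits.MatrixMultiplication.OmegaCensus.SmallFormats.MatMul22nRankGF5XCapTightExtras
import Summits.MatrixMultiplication.OmegaCensus.SmallFormats.MatMul22nRankGF5ThreeNPlusFiveReduction
import Summits.MatrixMultiplication.OmegaCensus.SmallFormats.FiveByFiveCosetMatrix
import HarnessLib

/-!
# ω-census family (a): `R_𝔽₅(⟨2,2,n⟩) ≥ 3n + 5` for every `n ≥ 36` — the slack-4 X-cap system has no LP-tight point

Cell `pub-omega` (unit `pub-omega-tensor-g12`), topic `Summits/MatrixMultiplication/OmegaCensus` (sub-folder `SmallFormats`).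
Framing (verbatim): lottery ticket; floor = certified bounds/negative ranges. HONEST FRAMING: a kernel theorem about ONE census cell
beyond print (`n = 36`: `R_𝔽₅(⟨2,2,36⟩) ≥ 113`, and `3n + 5` for all `n ≥ 36` over `𝔽₅`, one above the tree's `3n + 4`); it is NOT progress
on `ω`. It discharges the hypothesis `NoTightPoint5 4 112` ("`M₅(4) ≤ 111`") of `three_mul_add_five_le_of_noTightPoint5`
(`MatMul22nRankGF5ThreeNPlusFiveReduction`) WITHOUT the branch-and-bound replay planned by tensor g8–g11 (≈ 2·10⁴ LP leaves), by a
structure argument (tensor-g12 note `pub-omega-tensor-g12/METHOD-COSET-g12.md`):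

Let `x` be a nonnegative integer point of the 350 cap / row-plane rows of `xcapSys5s 4` in the box `[0,4]` with total `≥ 112`. By
`tight5_of_total_ge` / `rowPlane_tight_of_total_ge` it is LP-tight (`z = 0`, tangent rows `= 4`, row planes `= 8`). Identify the 120
invertible classes with `S₅` (natural action on five letters, table `natIm5`) and put `N i j = ∑_{g·i=j} x_g`. The decide-checked column
identities of `MatMul22nRankGF5XCapCosetData{,K}` turn tightness into: `N i j ≡ 2 (mod 3)`; `N i j − N i 0 − N 0 j + N 0 0 ≡ 0 (mod 5)`;
row and column sums `64`; `N[B × B'] = 32 + 3·(two passant rows) ∈ [32, 56]` for all 2-subsets `B, B'`. (Behind the tables: the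
`5'`/Steinberg part of `x` is carried by the cell matrix, the cuspidal part by `N` and its sign twist, and `30·x_g = N[g] ± N'[g] − 5μ[g] − 8`;
the block identity is `N[B×B'] = 32 + 3·mass{g : gB = B'}`.) `Coset5.no_cosetMatrix5` (`FiveByFiveCosetMatrix`) says no such `N` exists.
Hence `NoTightPoint5 4 112`, and `3n + 5 ≤ R_𝔽₅(⟨2,2,n⟩)` (all three orientations) for every `n ≥ 36`.
-/

namespace Summit.MatrixMultiplication.OmegaCensus.SmallFormats

open Finset Literature.Computability.AlgebraicComplexity

/-- The coset mass `N i j (x) = ∑_{g : g·i = j} x_g` as an integer linear form in the 156 class variables. -/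
def Nval (x : ℕ → ℕ) (i j : ℕ) : ℤ := ∑ g ∈ range 156, nInd5 i j g * (x g : ℤ)

/-- Coset masses are nonnegative. -/
theorem Nval_nonneg (x : ℕ → ℕ) (i j : ℕ) : 0 ≤ Nval x i j :=
  sum_nonneg fun g _ => mul_nonneg (by unfold nInd5; split_ifs <;> norm_num) (by positivity)

/-- LP-tightness data of a point of the slack-4 system: no zero forms, tangent rows at `4`, row planes at `8`, passant rows in `[0, 4]`. -/
structure Tight4 (x : ℕ → ℕ) : Prop where
  /-- no zero forms -/
  hz : x 156 = 0
  /-- tangent rows are tight -/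
  htan : ∀ r < 144, rowVal5 4 x r = 4
  /-- row-plane rows are tight -/
  hrul : ∀ r, 344 ≤ r → r < 350 → rowVal5 4 x r = 8
  /-- passant rows are capped -/
  hpas : ∀ r, 144 ≤ r → r < 344 → 0 ≤ rowVal5 4 x r ∧ rowVal5 4 x r ≤ 4

/-- Cap / row-plane rows have `0/1` coefficients, so their values are nonnegative. -/
theorem rowVal5_four_nonneg (x : ℕ → ℕ) {r : ℕ} (hr : r < 350) : 0 ≤ rowVal5 4 x r := by
  unfold rowVal5
  refine sum_nonneg fun j hj => mul_nonneg ?_ (by positivity)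
  rw [xcapSys5s_A, xcapSys5_A_eq' (by omega) (mem_range.1 hj), rowCoef5_eq_mem' hr (mem_range.1 hj)]
  split_ifs <;> norm_num

/-- A point of the 350 rows with total `≥ 112` is LP-tight. -/
theorem tight4_of_total_ge {x : ℕ → ℕ} (h350 : ∀ r < 350, rowVal5 4 x r ≤ rhs5s 4 r)
    (htot : 28 * ((4 : ℕ) : ℤ) ≤ ∑ j ∈ range 157, (x j : ℤ)) : Tight4 x where
  hz := (tight5_of_total_ge h350 htot).1
  htan r hr := by have := (tight5_of_total_ge h350 htot).2 r hr; simpa using this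
  hrul r h1 h2 := by have := rowPlane_tight_of_total_ge h350 htot r h1 h2; simpa using this
  hpas r h1 h2 := ⟨rowVal5_four_nonneg x (by omega), by
    have := h350 r (by omega); simpa [rhs5s, h2] using this⟩

section eval
variable {x : ℕ → ℕ}

/-- Regrouping by rows, with the WLOG rows silent: `∑_j (yᵀA)_j x_j = ∑_{r<350} y_r · row_r(x)`. -/
theorem sum_yA_mul_eq_sum_rowVal (y : ℕ → ℕ) (hy : ∀ r, 350 ≤ r → y r = 0) (x : ℕ → ℕ) :
    ∑ j ∈ range 157, xcapSys5.yA y j * (x j : ℤ) = ∑ r ∈ range 350, (y r : ℤ) * rowVal5 4 x r := by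
  rw [← sum_mul_rowVal5 (s := 4) y x, ← sum_range_add_sum_Ico _ (show 350 ≤ 498 by norm_num)]
  have h0 : ∑ r ∈ Ico 350 498, (y r : ℤ) * rowVal5 4 x r = 0 :=
    sum_eq_zero fun r hr => by rw [hy r (by simp only [mem_Ico] at hr; exact hr.1)]; simp
  rw [h0, add_zero]

/-- At a tight point the 350 rows evaluate to `tval4 y` plus the passant part. -/
theorem sum_rowVal_tight (T : Tight4 x) (y : ℕ → ℕ) :
    ∑ r ∈ range 350, (y r : ℤ) * rowVal5 4 x r = tval4 y + ∑ r ∈ Ico 144 344, (y r : ℤ) * rowVal5 4 x r := by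
  rw [← sum_range_add_sum_Ico _ (show 344 ≤ 350 by norm_num), ← sum_range_add_sum_Ico _ (show 144 ≤ 344 by norm_num)]
  have h1 : ∑ r ∈ range 144, (y r : ℤ) * rowVal5 4 x r = 4 * ∑ r ∈ range 144, (y r : ℤ) := by
    rw [mul_sum]; exact sum_congr rfl fun r hr => by rw [T.htan r (mem_range.1 hr)]; ring
  have h2 : ∑ r ∈ Ico 344 350, (y r : ℤ) * rowVal5 4 x r = 8 * ∑ r ∈ Ico 344 350, (y r : ℤ) := by
    rw [mul_sum]
    exact sum_congr rfl fun r hr => by simp only [mem_Ico] at hr; rw [T.hrul r hr.1 hr.2]; ring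
  rw [h1, h2, tval4]; ring

/-- With no zero forms the column `156` drops out of every form. -/
theorem sum157_eq_sum156 (T : Tight4 x) (F : ℕ → ℤ) :
    ∑ j ∈ range 157, F j * (x j : ℤ) = ∑ g ∈ range 156, F g * (x g : ℤ) := by
  rw [sum_range_succ, T.hz]; simp

/-- **Modular certificates.** If `F ≡ yᵀA (mod p)` column by column (`j < 156`) for tight-row multipliers `y`, then at a tight point
`∑_g F_g x_g ≡ tval4 y (mod p)`. -/
theorem sum_emod_of_cert (T : Tight4 x) (F : ℕ → ℤ) (y : ℕ → ℕ) (p : ℤ)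
    (hcol : ∀ g < 156, (F g - xcapSys5.yA y g) % p = 0) (hwlog : ∀ r, 350 ≤ r → y r = 0)
    (hpas : ∀ r, 144 ≤ r → r < 344 → y r = 0) :
    (∑ g ∈ range 156, F g * (x g : ℤ)) % p = tval4 y % p := by
  have hyA : ∑ g ∈ range 156, xcapSys5.yA y g * (x g : ℤ) = tval4 y := by
    rw [← sum157_eq_sum156 T, sum_yA_mul_eq_sum_rowVal y hwlog, sum_rowVal_tight T y]
    have : ∑ r ∈ Ico 144 344, (y r : ℤ) * rowVal5 4 x r = 0 :=
      sum_eq_zero fun r hr => by simp only [mem_Ico] at hr; rw [hpas r hr.1 hr.2]; simp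
    rw [this, add_zero]
  have hsplit : ∑ g ∈ range 156, F g * (x g : ℤ)
      = ∑ g ∈ range 156, (F g - xcapSys5.yA y g) * (x g : ℤ) + ∑ g ∈ range 156, xcapSys5.yA y g * (x g : ℤ) := by
    rw [← sum_add_distrib]; exact sum_congr rfl fun g _ => by ring
  have hdvd : p ∣ ∑ g ∈ range 156, (F g - xcapSys5.yA y g) * (x g : ℤ) :=
    dvd_sum fun g hg => dvd_mul_of_dvd_left (Int.dvd_of_emod_eq_zero (hcol g (mem_range.1 hg))) _
  obtain ⟨k, hk⟩ := hdvd
  rw [hsplit, hyA, hk, add_comm, Int.add_mul_emod_self_left]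

/-- **Exact certificates.** If `F = (y⁺)ᵀA − (y⁻)ᵀA` column by column (`j < 156`) for multipliers supported on the 350 cap / row-plane
rows, then at a tight point `∑_g F_g x_g = tval4 y⁺ − tval4 y⁻ + (passant part)`. -/
theorem sum_eq_of_cert (T : Tight4 x) (F : ℕ → ℤ) (yp ym : ℕ → ℕ)
    (hcol : ∀ g < 156, F g = xcapSys5.yA yp g - xcapSys5.yA ym g) (hwp : ∀ r, 350 ≤ r → yp r = 0)
    (hwm : ∀ r, 350 ≤ r → ym r = 0) :
    ∑ g ∈ range 156, F g * (x g : ℤ)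
      = tval4 yp - tval4 ym + ∑ r ∈ Ico 144 344, ((yp r : ℤ) - ym r) * rowVal5 4 x r := by
  have e : ∑ g ∈ range 156, F g * (x g : ℤ)
      = ∑ g ∈ range 156, xcapSys5.yA yp g * (x g : ℤ) - ∑ g ∈ range 156, xcapSys5.yA ym g * (x g : ℤ) := by
    rw [← sum_sub_distrib]; exact sum_congr rfl fun g hg => by rw [hcol g (mem_range.1 hg)]; ring
  rw [e, ← sum157_eq_sum156 T, ← sum157_eq_sum156 T, sum_yA_mul_eq_sum_rowVal yp hwp, sum_yA_mul_eq_sum_rowVal ym hwm,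
    sum_rowVal_tight T yp, sum_rowVal_tight T ym]
  have : ∑ r ∈ Ico 144 344, ((yp r : ℤ) - ym r) * rowVal5 4 x r
      = ∑ r ∈ Ico 144 344, (yp r : ℤ) * rowVal5 4 x r - ∑ r ∈ Ico 144 344, (ym r : ℤ) * rowVal5 4 x r := by
    rw [← sum_sub_distrib]; exact sum_congr rfl fun r _ => by ring
  rw [this]; ring

/-- Packed tight-row multipliers vanish on the WLOG rows. -/
theorem yTight5_wlog (w P r : ℕ) (hr : 350 ≤ r) : yTight5 w P r = 0 := by
  simp [yTight5, show ¬ r < 144 by omega, show ¬ (344 ≤ r ∧ r < 350) by omega]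

/-- Packed tight-row multipliers vanish on the passant rows. -/
theorem yTight5_pas (w P r : ℕ) (h1 : 144 ≤ r) (h2 : r < 344) : yTight5 w P r = 0 := by
  simp [yTight5, show ¬ r < 144 by omega, show ¬ (344 ≤ r ∧ r < 350) by omega]

/-- Offset-packed tight-row multipliers vanish on the WLOG rows. -/
theorem yTightOff5_wlog (w P off r : ℕ) (hr : 350 ≤ r) : yTightOff5 w P off r = 0 := by
  simp [yTightOff5, show ¬ r < 144 by omega, show ¬ (344 ≤ r ∧ r < 350) by omega]

/-- Offset-packed tight-row multipliers vanish on the passant rows. -/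
theorem yTightOff5_pas (w P off r : ℕ) (h1 : 144 ≤ r) (h2 : r < 344) : yTightOff5 w P off r = 0 := by
  simp [yTightOff5, show ¬ r < 144 by omega, show ¬ (344 ≤ r ∧ r < 350) by omega]

/-! ## The four facts about the coset masses of a tight point -/

/-- (A) `N i j ≡ 2 (mod 3)`. -/
theorem Nval_emod_three (T : Tight4 x) {i j : ℕ} (hi : i < 5) (hj : j < 5) : Nval x i j % 3 = 2 := by
  have hc : 5 * i + j < 25 := by omega
  have h := sum_emod_of_cert T (nInd5 i j) (yA5c (5 * i + j)) 3 (fun g hg => by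
      have := certA5_col ⟨5 * i + j, hc⟩ ⟨g, hg⟩
      simp only at this
      rwa [show (5 * i + j) / 5 = i by omega, show (5 * i + j) % 5 = j by omega] at this)
    (fun r hr => yTight5_wlog _ _ r hr) (fun r h1 h2 => yTight5_pas _ _ r h1 h2)
  rw [Nval, h]
  exact certA5_val ⟨5 * i + j, hc⟩

/-- (B) `N i j − N i 0 − N 0 j + N 0 0 ≡ 0 (mod 5)` for `1 ≤ i, j < 5`. -/
theorem Nval_contrast_emod_five (T : Tight4 x) {i j : ℕ} (hi1 : 1 ≤ i) (hi : i < 5) (hj1 : 1 ≤ j) (hj : j < 5) :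
    (Nval x i j - Nval x i 0 - Nval x 0 j + Nval x 0 0) % 5 = 0 := by
  have hc : 4 * (i - 1) + (j - 1) < 16 := by omega
  have h := sum_emod_of_cert T (contraForm5 i j) (yB5c (4 * (i - 1) + (j - 1))) 5 (fun g hg => by
      have := certB5_col ⟨4 * (i - 1) + (j - 1), hc⟩ ⟨g, hg⟩
      simp only at this
      rwa [show (4 * (i - 1) + (j - 1)) / 4 + 1 = i by omega, show (4 * (i - 1) + (j - 1)) % 4 + 1 = j by omega] at this)
    (fun r hr => yTight5_wlog _ _ r hr) (fun r h1 h2 => yTight5_pas _ _ r h1 h2)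
  rw [certB5_val ⟨_, hc⟩] at h
  have e : ∑ g ∈ range 156, contraForm5 i j g * (x g : ℤ) = Nval x i j - Nval x i 0 - Nval x 0 j + Nval x 0 0 := by
    simp only [contraForm5, Nval, ← sum_sub_distrib, ← sum_add_distrib]
    exact sum_congr rfl fun g _ => by ring
  rw [← e, h]

/-- (M) row sums `∑_j N i j = 64`. -/
theorem Nval_rowsum (T : Tight4 x) {i : ℕ} (hi : i < 5) : ∑ j ∈ range 5, Nval x i j = 64 := by
  have h := sum_eq_of_cert T (margForm5 i) (yMp5 i) (yMm5 i) (fun g hg => certM5_col ⟨i, by omega⟩ ⟨g, hg⟩)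
    (fun r hr => yTight5_wlog _ _ r hr) (fun r hr => yTight5_wlog _ _ r hr)
  have hp : ∑ r ∈ Ico 144 344, ((yMp5 i r : ℤ) - yMm5 i r) * rowVal5 4 x r = 0 := sum_eq_zero fun r hr => by
    simp only [mem_Ico] at hr
    rw [show yMp5 i r = 0 from yTight5_pas _ _ r hr.1 hr.2, show yMm5 i r = 0 from yTight5_pas _ _ r hr.1 hr.2]; simp
  rw [hp, add_zero, certM5_val ⟨i, by omega⟩] at h
  rw [← h]
  have e : ∀ g ∈ range 156, margForm5 i g * (x g : ℤ) = ∑ j ∈ range 5, nInd5 i j g * (x g : ℤ) := fun g _ => by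
    rw [margForm5, if_pos hi, sum_mul]
  rw [sum_congr rfl e, sum_comm]; rfl

/-- (M) column sums `∑_i N i j = 64`. -/
theorem Nval_colsum (T : Tight4 x) {j : ℕ} (hj : j < 5) : ∑ i ∈ range 5, Nval x i j = 64 := by
  have h := sum_eq_of_cert T (margForm5 (j + 5)) (yMp5 (j + 5)) (yMm5 (j + 5)) (fun g hg => certM5_col ⟨j + 5, by omega⟩ ⟨g, hg⟩)
    (fun r hr => yTight5_wlog _ _ r hr) (fun r hr => yTight5_wlog _ _ r hr)
  have hp : ∑ r ∈ Ico 144 344, ((yMp5 (j + 5) r : ℤ) - yMm5 (j + 5) r) * rowVal5 4 x r = 0 := sum_eq_zero fun r hr => by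
    simp only [mem_Ico] at hr
    rw [show yMp5 (j + 5) r = 0 from yTight5_pas _ _ r hr.1 hr.2, show yMm5 (j + 5) r = 0 from yTight5_pas _ _ r hr.1 hr.2]
    simp
  rw [hp, add_zero, certM5_val ⟨j + 5, by omega⟩] at h
  rw [← h]
  have e : ∀ g ∈ range 156, margForm5 (j + 5) g * (x g : ℤ) = ∑ i ∈ range 5, nInd5 i j g * (x g : ℤ) := fun g _ => by
    rw [margForm5, if_neg (by omega), show j + 5 - 5 = j by omega, sum_mul]
  rw [sum_congr rfl e, sum_comm]; rfl

/-- (K) block sums: for 2-subsets `p, p'`, `32 ≤ N[B_p × B_{p'}] ≤ 56`. -/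
theorem Nval_block (T : Tight4 x) (p p' : Fin 10) :
    32 ≤ Nval x (pairA5 p) (pairA5 p') + Nval x (pairA5 p) (pairB5 p') + Nval x (pairB5 p) (pairA5 p') + Nval x (pairB5 p) (pairB5 p')
    ∧ Nval x (pairA5 p) (pairA5 p') + Nval x (pairA5 p) (pairB5 p') + Nval x (pairB5 p) (pairA5 p') + Nval x (pairB5 p) (pairB5 p')
      ≤ 56 := by
  set c : Fin 100 := ⟨10 * p.val + p'.val, by omega⟩ with hc
  have hdiv : c.val / 10 = p.val := by show (10 * p.val + p'.val) / 10 = p.val; omega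
  have hmod : c.val % 10 = p'.val := by show (10 * p.val + p'.val) % 10 = p'.val; omega
  have h := sum_eq_of_cert T (blockForm5 c.val) (yKp5 c.val) (yKm5 c.val) (fun g hg => certK5_col c ⟨g, hg⟩)
    (fun r hr => by
      obtain ⟨h1, h2, h3, h4, _⟩ := pasK5_range c
      simp [yKp5, yTightOff5_wlog _ _ _ r hr, show r ≠ pas1K5 c.val by omega, show r ≠ pas2K5 c.val by omega])
    (fun r hr => yTightOff5_wlog _ _ _ r hr)
  obtain ⟨h1, h2, h3, h4, hne⟩ := pasK5_range c
  -- the passant part is `3·row_{p1} + 3·row_{p2}`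
  have hp : ∑ r ∈ Ico 144 344, ((yKp5 c.val r : ℤ) - yKm5 c.val r) * rowVal5 4 x r
      = 3 * rowVal5 4 x (pas1K5 c.val) + 3 * rowVal5 4 x (pas2K5 c.val) := by
    have e : ∀ r ∈ Ico 144 344, ((yKp5 c.val r : ℤ) - yKm5 c.val r) * rowVal5 4 x r
        = (if r = pas1K5 c.val then 3 * rowVal5 4 x r else 0) + (if r = pas2K5 c.val then 3 * rowVal5 4 x r else 0) := by
      intro r hr
      simp only [mem_Ico] at hr
      simp only [yKp5, yKm5, yTightOff5_pas _ _ _ r hr.1 hr.2, zero_add, Nat.cast_zero, sub_zero]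
      by_cases e1 : r = pas1K5 c.val
      · have e2 : r ≠ pas2K5 c.val := by rw [e1]; exact hne
        simp [e1, hne]
      · by_cases e2 : r = pas2K5 c.val
        · simp [e2, hne.symm]
        · simp [e1, e2]
    rw [sum_congr rfl e, sum_add_distrib, sum_ite_eq' (Ico 144 344), sum_ite_eq' (Ico 144 344),
      if_pos (mem_Ico.2 ⟨h1, h2⟩), if_pos (mem_Ico.2 ⟨h3, h4⟩)]
  rw [hp, certK5_val c] at h
  have e : ∑ g ∈ range 156, blockForm5 c.val g * (x g : ℤ) = Nval x (pairA5 p) (pairA5 p') + Nval x (pairA5 p) (pairB5 p')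
      + Nval x (pairB5 p) (pairA5 p') + Nval x (pairB5 p) (pairB5 p') := by
    simp only [blockForm5, hdiv, hmod, Nval, ← sum_add_distrib]
    exact sum_congr rfl fun g _ => by ring
  rw [← e, h]
  have q1 := T.hpas _ h1 h2
  have q2 := T.hpas _ h3 h4
  constructor <;> linarith [q1.1, q1.2, q2.1, q2.2]

end eval

/-- Every pair of distinct letters is one of the ten tabulated 2-subsets (in some order). -/
theorem pair5_cover : ∀ a b : Fin 5, a ≠ b →
    ∃ p : Fin 10, (pairA5 p.val = a.val ∧ pairB5 p.val = b.val) ∨ (pairA5 p.val = b.val ∧ pairB5 p.val = a.val) := by decide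

/-- **`M₅(4) ≤ 111` (kernel).** The 350 cap / row-plane rows of the slack-4 X-cap system over `𝔽₅` have no nonnegative integer point in
`[0,4]^157` of total `≥ 112`. -/
theorem noTightPoint5_4_112 : NoTightPoint5 4 112 := by
  intro x _hbox h350
  by_contra hlt
  have htot : 28 * ((4 : ℕ) : ℤ) ≤ ∑ j ∈ range 157, (x j : ℤ) := by push_cast at hlt ⊢; linarith
  have T := tight4_of_total_ge h350 htot
  -- the coset-mass matrix as natural numbers
  let M : Fin 5 → Fin 5 → ℕ := fun i j => (Nval x i j).toNat
  have hM : ∀ i j : Fin 5, (M i j : ℤ) = Nval x i j := fun i j => Int.toNat_of_nonneg (Nval_nonneg x i j)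
  refine Coset5.no_cosetMatrix5 M (fun i j => ?_) (fun i => ?_) (fun j => ?_) (fun i i' j j' hi hj => ?_) (fun i i' j j' => ?_)
  · have h := Nval_emod_three T i.isLt j.isLt
    have := hM i j; omega
  · have h := Nval_rowsum T i.isLt
    simp only [sum_range_succ, sum_range_zero, zero_add] at h
    have e0 := hM i 0; have e1 := hM i 1; have e2 := hM i 2; have e3 := hM i 3; have e4 := hM i 4
    simp only [Fin.val_zero, Fin.val_one, Fin.val_two] at e0 e1 e2
    have v3 : ((3 : Fin 5) : ℕ) = 3 := rfl
    have v4 : ((4 : Fin 5) : ℕ) = 4 := rfl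
    rw [v3] at e3; rw [v4] at e4
    omega
  · have h := Nval_colsum T j.isLt
    simp only [sum_range_succ, sum_range_zero, zero_add] at h
    have e0 := hM 0 j; have e1 := hM 1 j; have e2 := hM 2 j; have e3 := hM 3 j; have e4 := hM 4 j
    simp only [Fin.val_zero, Fin.val_one, Fin.val_two] at e0 e1 e2
    have v3 : ((3 : Fin 5) : ℕ) = 3 := rfl
    have v4 : ((4 : Fin 5) : ℕ) = 4 := rfl
    rw [v3] at e3; rw [v4] at e4
    omega
  · obtain ⟨p, hp⟩ := pair5_cover i i' hi
    obtain ⟨p', hp'⟩ := pair5_cover j j' hj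
    have hb := Nval_block T p p'
    have e1 := hM i j; have e2 := hM i j'; have e3 := hM i' j; have e4 := hM i' j'
    rcases hp with ⟨ha, hb'⟩ | ⟨ha, hb'⟩ <;> rcases hp' with ⟨ha', hb''⟩ | ⟨ha', hb''⟩ <;>
      (rw [ha, hb', ha', hb''] at hb; omega)
  · -- all contrasts from the basic ones
    have basic : ∀ a b : Fin 5, (Nval x a b - Nval x a 0 - Nval x 0 b + Nval x 0 0) % 5 = 0 := by
      intro a b
      by_cases ha : a.val = 0
      · rw [ha]; simp
      by_cases hb : b.val = 0
      · rw [hb]; simp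
      exact Nval_contrast_emod_five T (by omega) a.isLt (by omega) b.isLt
    have b1 := basic i j; have b2 := basic i j'; have b3 := basic i' j; have b4 := basic i' j'
    have e1 := hM i j; have e2 := hM i j'; have e3 := hM i' j; have e4 := hM i' j'
    omega

/-- **`R_𝔽₅(⟨2,2,n⟩) ≥ 3n + 5` for every `n ≥ 36`** (kernel; one above the tree's `3n + 4`, and for `n = 36` beyond every printed floor). -/
theorem three_mul_add_five_le_tensorRank_matMulTensor_22n_gf5 (n : ℕ) (hn : 36 ≤ n) :
    3 * n + 5 ≤ tensorRank (matMulTensor (ZMod 5) 2 2 n) :=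
  three_mul_add_five_le_of_noTightPoint5 noTightPoint5_4_112 n hn

/-- The same bound for all three orientations `⟨2,2,n⟩`, `⟨2,n,2⟩`, `⟨n,2,2⟩` over `𝔽₅`, `n ≥ 36`. -/
theorem three_mul_add_five_le_tensorRank_matMulTensor_gf5_orientations (n : ℕ) (hn : 36 ≤ n) :
    3 * n + 5 ≤ tensorRank (matMulTensor (ZMod 5) 2 2 n) ∧ 3 * n + 5 ≤ tensorRank (matMulTensor (ZMod 5) 2 n 2) ∧
      3 * n + 5 ≤ tensorRank (matMulTensor (ZMod 5) n 2 2) :=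
  three_mul_add_five_le_orientations_of_noTightPoint5 noTightPoint5_4_112 n hn

/-- The census cell `n = 36`: `R_𝔽₅(⟨2,2,36⟩) ≥ 113`. -/
theorem tensorRank_matMulTensor_2_2_36_gf5_ge : 113 ≤ tensorRank (matMulTensor (ZMod 5) 2 2 36) :=
  three_mul_add_five_le_tensorRank_matMulTensor_22n_gf5 36 le_rfl

end Summit.MatrixMultiplication.OmegaCensus.SmallFormats
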